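import Mathlib
import Literature.NumberTheory.Sieve.LinearEquationsInPrimes
import Literature.NumberTheory.Sieve.LinearEquationsInPrimesProofs
import Summits.Parity.GeneralizedHardyLittlewood.Theorems.LeeYangFibresRelativeDimOneLocalAverage
import Summits.Parity.GeneralizedHardyLittlewood.Theorems.LiouvilleShiftedTablesPairsToGHLStubSlopedEulerAux1

/-!
# Sloped ladder, Euler stub — part 3: local factors of `vecCons ψ Φ` and the Euler product

Route `LiouvilleShiftedTables` (Parity / GeneralizedHardyLittlewood), crux stmt-Parity-9389
(`PairsToGHL`), line `sloped_ladder`, stub `stub_slopedEuler`.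

The singular-series identity `𝔖(vecCons ψ Φ) = 𝔖(Φ) · ∑_n b(n)/n` behind the rung, prime by
prime (Green–Tao 2010, (1.6)–(1.7)):

* `eval_vecSingle`, `eval_const_fin_one`, `isNondegenerateSystem_tail`, `det_ne_zero` — `d = 1`
  bookkeeping: `φ(n) = φ̇(e₁) n + φ(0)`, the tail `Φ` of a non-degenerate `vecCons ψ Φ` is
  non-degenerate, and `ψ` is proportional to no `Φᵢ` (`α cᵢ - aᵢ β ≠ 0`);
* `localFactor_vecCons` — `β_p(vecCons ψ Φ) = (p/(p-1)) (1 - w̃(p)) β_p(Φ)` for every prime `p`,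
  from `w̃(p) · #{Φ-good} = #{Φ-good roots of ψ}` (part 1, `weight_prime_mul_card`);
* `tsum_pow_div_eq` , `tendsto_prod_primesLE_eulerFactor` — the Euler product
  `∏_{p ≤ x} (p/(p-1))(1 - w̃(p)) → ∑_n b(n)/n` for the multiplicative weight `b` with
  `b(p^k) = 1 - p w̃(p)` (Mathlib's `EulerProduct.eulerProduct`);
* `singularProduct_vecCons` — hence `𝔖(vecCons ψ Φ) = 𝔖(Φ) · ∑_n b(n)/n` by the ordered limits
  (`tendsto_singularProductPartial_holds`).

[folklore]
-/

noncomputable section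

open Finset Filter ArithmeticFunction
open scoped Topology

namespace Summit.Parity.GeneralizedHardyLittlewood.Theorems.PairsToGHL.SlopedLadder

open Literature.NumberTheory.Sieve
open Summit.Parity.GeneralizedHardyLittlewood.Cruxes.RelativeDimOne.TranslateAmplification
  (localFactor_fin_one)

variable {t : ℕ}

/-! ### `d = 1` bookkeeping -/

/-- `φ(![x]) = φ̇(e₁) x + φ(0)`. [folklore] -/
theorem eval_vecSingle (φ : AffLinForm 1) (x : ℤ) : φ.eval ![x] = φ.coeff 0 * x + φ.const := by
  simp [AffLinForm.eval]

/-- `φ(x) = φ̇(e₁) x + φ(0)` on the constant vector. [folklore] -/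
theorem eval_const_fin_one (φ : AffLinForm 1) (x : ℤ) :
    φ.eval (fun _ => x) = φ.coeff 0 * x + φ.const := by
  simp [AffLinForm.eval]

/-- `φ(n) = φ̇(e₁) n₀ + φ(0)` for every `n ∈ ℤ¹`. [folklore] -/
theorem eval_fin_one (φ : AffLinForm 1) (n : Fin 1 → ℤ) :
    φ.eval n = φ.coeff 0 * n 0 + φ.const := by
  simp [AffLinForm.eval]

/-- The tail of a non-degenerate system `vecCons ψ Φ` is non-degenerate. [folklore] -/
theorem isNondegenerateSystem_tail (Φ : Fin t → AffLinForm 1) (ψ : AffLinForm 1)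
    (h : IsNondegenerateSystem (Matrix.vecCons ψ Φ)) : IsNondegenerateSystem Φ := by
  refine ⟨fun i => ?_, fun i j hij a b hab => ?_⟩
  · have := h.1 i.succ
    rwa [Matrix.cons_val_succ] at this
  · refine h.2 i.succ j.succ (fun e => hij (Fin.succ_injective _ e)) a b fun n => ?_
    rw [Matrix.cons_val_succ, Matrix.cons_val_succ]
    exact hab n

/-- In a non-degenerate `vecCons ψ Φ` with `ψ̇ ≠ 0`, `ψ` is proportional to no `Φᵢ`:
`α cᵢ - aᵢ β ≠ 0`. [folklore] -/
theorem det_ne_zero (Φ : Fin t → AffLinForm 1) (ψ : AffLinForm 1)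
    (h : IsNondegenerateSystem (Matrix.vecCons ψ Φ)) (hα : ψ.coeff 0 ≠ 0) (i : Fin t) :
    ψ.coeff 0 * (Φ i).const - (Φ i).coeff 0 * ψ.const ≠ 0 := by
  intro hdet
  have key := h.2 0 i.succ (Fin.succ_ne_zero i).symm ((Φ i).coeff 0) (ψ.coeff 0) fun n => by
    rw [Matrix.cons_val_zero, Matrix.cons_val_succ, eval_fin_one, eval_fin_one]
    linear_combination (-1 : ℤ) * hdet
  exact hα key.2

/-! ### The local factor of `vecCons ψ Φ` at a prime -/

/-- For a prime `p`: `∏ᵢ Λ_p(Φᵢ(c)) = (p/(p-1))^t · 𝟙[c is Φ-good]`. [cite: GreenTao2010, (1.6)] -/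
theorem prod_localVonMangoldt_eq (Φ : Fin t → AffLinForm 1) {p : ℕ} (hp : p.Prime) (c : ℕ) :
    ∏ i, localVonMangoldt p ((Φ i).eval fun _ => (c : ℤ)) =
      if ∀ i, Int.gcd ((Φ i).coeff 0 * c + (Φ i).const) p = 1 then
        ((p : ℝ) / (p - 1)) ^ t else 0 := by
  simp only [localVonMangoldt, eval_const_fin_one, Nat.totient_prime hp, Nat.cast_sub hp.one_le,
    Nat.cast_one]
  rw [Finset.prod_ite_zero]
  simp only [Finset.mem_univ, forall_const, Finset.prod_const, Finset.card_univ, Fintype.card_fin]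

/-- **`β_p(vecCons ψ Φ) = (p/(p-1)) (1 - w̃(p)) β_p(Φ)`** for every prime `p`, given the identity
`w̃(p) · #{c < p : Φ-good} = #{c < p : p ∣ ψ(c), Φ-good}` (the three cases `p ∤ α`; `p ∣ α, p ∤ β`;
`p ∣ α, p ∣ β` of part 1). [cite: GreenTao2010, (1.6)] -/
theorem localFactor_vecCons (Φ : Fin t → AffLinForm 1) (ψ : AffLinForm 1) {p : ℕ} (hp : p.Prime)
    (w : ℝ)
    (hw : w * (#((range p).filter (fun ρ' : ℕ =>
        ∀ i, Int.gcd ((Φ i).coeff 0 * ρ' + (Φ i).const) p = 1)) : ℝ) =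
      (#((range p).filter (fun ρ : ℕ => (p : ℤ) ∣ ψ.coeff 0 * ρ + ψ.const ∧
        ∀ i, Int.gcd ((Φ i).coeff 0 * ρ + (Φ i).const) p = 1)) : ℝ)) :
    localFactor (Matrix.vecCons ψ Φ) p = (p : ℝ) / (p - 1) * (1 - w) * localFactor Φ p := by
  -- `β_p(Φ)` as a count
  have hΦ : localFactor Φ p = (p : ℝ)⁻¹ * (((p : ℝ) / (p - 1)) ^ t *
      #((range p).filter (fun c : ℕ =>
        ∀ i, Int.gcd ((Φ i).coeff 0 * c + (Φ i).const) p = 1))) := by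
    rw [localFactor_fin_one]
    congr 1
    rw [Finset.sum_congr rfl (fun c _ => prod_localVonMangoldt_eq Φ hp c), ← Finset.sum_filter,
      Finset.sum_const, nsmul_eq_mul, mul_comm]
  -- the weight of `ψ` at `c`
  have hψ : ∀ c : ℕ, localVonMangoldt p (ψ.eval fun _ => (c : ℤ)) =
      if ¬ (p : ℤ) ∣ ψ.coeff 0 * c + ψ.const then (p : ℝ) / (p - 1) else 0 := by
    intro c
    rw [localVonMangoldt, eval_const_fin_one, Nat.totient_prime hp, Nat.cast_sub hp.one_le,
      Nat.cast_one]
    by_cases h : (p : ℤ) ∣ ψ.coeff 0 * c + ψ.const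
    · rw [if_neg (fun h1 => (int_gcd_prime_eq_one_iff hp _).mp h1 h), if_neg (not_not.mpr h)]
    · rw [if_pos ((int_gcd_prime_eq_one_iff hp _).mpr h), if_pos h]
  -- `β_p(vecCons ψ Φ)` as a count
  have hΦ' : localFactor (Matrix.vecCons ψ Φ) p = (p : ℝ)⁻¹ * (((p : ℝ) / (p - 1)) ^ (t + 1) *
      #((range p).filter (fun c : ℕ => ¬ (p : ℤ) ∣ ψ.coeff 0 * c + ψ.const ∧
        ∀ i, Int.gcd ((Φ i).coeff 0 * c + (Φ i).const) p = 1))) := by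
    rw [localFactor_fin_one]
    congr 1
    have hterm : ∀ c ∈ range p,
        ∏ i, localVonMangoldt p ((Matrix.vecCons ψ Φ i).eval fun _ => (c : ℤ)) =
          if ¬ (p : ℤ) ∣ ψ.coeff 0 * c + ψ.const ∧
              ∀ i, Int.gcd ((Φ i).coeff 0 * c + (Φ i).const) p = 1 then
            ((p : ℝ) / (p - 1)) ^ (t + 1) else 0 := by
      intro c _
      rw [Fin.prod_univ_succ, Matrix.cons_val_zero]
      simp only [Matrix.cons_val_succ]
      rw [prod_localVonMangoldt_eq Φ hp c, hψ, ite_zero_mul_ite_zero, pow_succ,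
        mul_comm (((p : ℝ) / (p - 1)) ^ t) ((p : ℝ) / (p - 1))]
    rw [Finset.sum_congr rfl hterm, ← Finset.sum_filter, Finset.sum_const, nsmul_eq_mul, mul_comm]
  -- `#{p ∤ ψ(c), good} = #{good} - #{p ∣ ψ(c), good}`
  have hsplit : (#((range p).filter (fun c : ℕ => ¬ (p : ℤ) ∣ ψ.coeff 0 * c + ψ.const ∧
      ∀ i, Int.gcd ((Φ i).coeff 0 * c + (Φ i).const) p = 1)) : ℝ) =
      #((range p).filter (fun c : ℕ => ∀ i, Int.gcd ((Φ i).coeff 0 * c + (Φ i).const) p = 1)) -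
        #((range p).filter (fun c : ℕ => (p : ℤ) ∣ ψ.coeff 0 * c + ψ.const ∧
          ∀ i, Int.gcd ((Φ i).coeff 0 * c + (Φ i).const) p = 1)) := by
    have h := Finset.card_filter_add_card_filter_not
      (s := (range p).filter (fun c : ℕ => ∀ i, Int.gcd ((Φ i).coeff 0 * c + (Φ i).const) p = 1))
      (fun c : ℕ => (p : ℤ) ∣ ψ.coeff 0 * c + ψ.const)
    rw [Finset.filter_filter, Finset.filter_filter] at h
    have e1 : (range p).filter (fun c : ℕ =>
        (∀ i, Int.gcd ((Φ i).coeff 0 * c + (Φ i).const) p = 1) ∧ (p : ℤ) ∣ ψ.coeff 0 * c + ψ.const) =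
        (range p).filter (fun c : ℕ => (p : ℤ) ∣ ψ.coeff 0 * c + ψ.const ∧
          ∀ i, Int.gcd ((Φ i).coeff 0 * c + (Φ i).const) p = 1) :=
      Finset.filter_congr fun c _ => and_comm
    have e2 : (range p).filter (fun c : ℕ =>
        (∀ i, Int.gcd ((Φ i).coeff 0 * c + (Φ i).const) p = 1) ∧ ¬ (p : ℤ) ∣ ψ.coeff 0 * c + ψ.const) =
        (range p).filter (fun c : ℕ => ¬ (p : ℤ) ∣ ψ.coeff 0 * c + ψ.const ∧
          ∀ i, Int.gcd ((Φ i).coeff 0 * c + (Φ i).const) p = 1) :=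
      Finset.filter_congr fun c _ => and_comm
    rw [e1, e2] at h
    rw [eq_sub_iff_add_eq, ← Nat.cast_add, add_comm, h]
  rw [hΦ', hΦ, hsplit, ← hw, pow_succ]
  ring

/-! ### The Euler product `∑_n b(n)/n = ∏_p (p/(p-1))(1 - w̃(p))` -/

/-- The local Euler factor: for `b` with `b(1) = 1`, `b(p^k) = 1 - p w̃(p)` (`k ≥ 1`),
`∑_e b(p^e)/p^e = 1 + (1 - p w̃(p))/(p - 1) = (p/(p-1))(1 - w̃(p))`. [folklore] -/
theorem tsum_pow_div_eq (b : ArithmeticFunction ℝ) (hb1 : b 1 = 1) (W : ℕ → ℝ) {p : ℕ}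
    (hp : p.Prime) (hbp : ∀ k : ℕ, 1 ≤ k → b (p ^ k) = 1 - p * W p) :
    HasSum (fun e : ℕ => b (p ^ e) / (p ^ e : ℕ)) ((p : ℝ) / (p - 1) * (1 - W p)) := by
  have hp2 : (2 : ℝ) ≤ p := by exact_mod_cast hp.two_le
  set r : ℝ := (p : ℝ)⁻¹ with hr
  have hr0 : 0 ≤ r := by positivity
  have hr1 : r < 1 := by rw [hr]; exact inv_lt_one_of_one_lt₀ (by linarith)
  set βv : ℝ := 1 - p * W p with hβ
  have hfe : ∀ e : ℕ, b (p ^ (e + 1)) / (p ^ (e + 1) : ℕ) = βv * r * r ^ e := by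
    intro e
    rw [hbp (e + 1) (by omega), Nat.cast_pow, hβ, hr, div_eq_mul_inv, ← inv_pow, pow_succ]
    ring
  have htail : HasSum (fun e : ℕ => b (p ^ (e + 1)) / (p ^ (e + 1) : ℕ)) (βv * r * (1 - r)⁻¹) := by
    simp_rw [hfe]
    exact (hasSum_geometric_of_lt_one hr0 hr1).mul_left _
  have h0 : b (p ^ 0) / ((p ^ 0 : ℕ) : ℝ) = 1 := by simp [hb1]
  have := htail.zero_add (f := fun e : ℕ => b (p ^ e) / (p ^ e : ℕ))
  rw [h0] at this
  convert this using 1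
  have hp0 : (p : ℝ) ≠ 0 := by positivity
  have hp1 : (p : ℝ) - 1 ≠ 0 := by linarith
  rw [hβ, hr]
  field_simp
  ring

/-- **Euler product of `∑ b(n)/n` along `p ≤ x`.** For a multiplicative `b` with
`b(p^k) = 1 - p w̃(p)` (`k ≥ 1`) and `∑ |b(n)|/n < ∞`:
`∏_{p ≤ x} (p/(p-1))(1 - w̃(p)) → ∑_n b(n)/n` as `x → ∞`. [folklore] -/
theorem tendsto_prod_primesLE_eulerFactor (b : ArithmeticFunction ℝ) (hb : b.IsMultiplicative)
    (hsum : Summable fun n : ℕ => ‖b n / n‖) (W : ℕ → ℝ)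
    (hbp : ∀ p k : ℕ, p.Prime → 1 ≤ k → b (p ^ k) = 1 - p * W p) :
    Tendsto (fun x : ℕ => ∏ p ∈ Nat.primesLE x, ((p : ℝ) / (p - 1) * (1 - W p))) atTop
      (𝓝 (∑' n : ℕ, b n / n)) := by
  set f : ℕ → ℝ := fun n => b n / n with hf
  have hf1 : f 1 = 1 := by simp [hf, hb.map_one]
  have hfmul : ∀ {m n : ℕ}, Nat.Coprime m n → f (m * n) = f m * f n := by
    intro m n hmn
    simp only [hf]
    rw [hb.map_mul_of_coprime hmn, Nat.cast_mul, mul_div_mul_comm]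
  have hf0 : f 0 = 0 := by simp [hf]
  have hE := (EulerProduct.eulerProduct hf1 hfmul hsum hf0).comp (tendsto_add_atTop_nat 1)
  refine hE.congr fun x => ?_
  simp only [Function.comp_apply]
  refine Finset.prod_congr rfl fun p hpx => ?_
  have hp : p.Prime := Nat.prime_of_mem_primesBelow hpx
  have h := tsum_pow_div_eq b hb.map_one W hp (fun k hk => hbp p k hp hk)
  simp only [hf]
  rw [← h.tsum_eq]

/-! ### The singular product of `vecCons ψ Φ` -/

/-- `∏_{p ≤ x} β_p(vecCons ψ Φ) = (∏_{p ≤ x} r_p) · ∏_{p ≤ x} β_p(Φ)` when `β_p(vecCons ψ Φ) = r_p β_p(Φ)`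
prime by prime. [folklore] -/
theorem singularProductPartial_vecCons (Φ : Fin t → AffLinForm 1) (ψ : AffLinForm 1) (r : ℕ → ℝ)
    (hloc : ∀ p : ℕ, p.Prime → localFactor (Matrix.vecCons ψ Φ) p = r p * localFactor Φ p)
    (x : ℕ) :
    singularProductPartial (Matrix.vecCons ψ Φ) x =
      (∏ p ∈ Nat.primesLE x, r p) * singularProductPartial Φ x := by
  rw [singularProductPartial, singularProductPartial, ← Finset.prod_mul_distrib]
  exact Finset.prod_congr rfl fun p hp => hloc p (Nat.prime_of_mem_primesLE hp)

/-- **`𝔖(vecCons ψ Φ) = H₀ · 𝔖(Φ)`.** If `β_p(vecCons ψ Φ) = r_p β_p(Φ)` for every prime and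
`∏_{p ≤ x} r_p → H₀`, then, `vecCons ψ Φ` being non-degenerate (so that `∏_{p ≤ x} β_p(Φ) → 𝔖(Φ)`,
`tendsto_singularProductPartial_holds`), the ordered singular products satisfy
`𝔖(vecCons ψ Φ) = H₀ 𝔖(Φ)`. [cite: GreenTao2010, (1.7)] -/
theorem singularProduct_vecCons (Φ : Fin t → AffLinForm 1) (ψ : AffLinForm 1)
    (hnd : IsNondegenerateSystem (Matrix.vecCons ψ Φ)) (r : ℕ → ℝ) (H₀ : ℝ)
    (hr : Tendsto (fun x : ℕ => ∏ p ∈ Nat.primesLE x, r p) atTop (𝓝 H₀))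
    (hloc : ∀ p : ℕ, p.Prime → localFactor (Matrix.vecCons ψ Φ) p = r p * localFactor Φ p) :
    singularProduct (Matrix.vecCons ψ Φ) = H₀ * singularProduct Φ := by
  have hΦ := isNondegenerateSystem_tail Φ ψ hnd
  have h1 : Tendsto (singularProductPartial Φ) atTop (𝓝 (singularProduct Φ)) :=
    tendsto_singularProductPartial_holds 1 t Φ hΦ
  have h2 : Tendsto (singularProductPartial (Matrix.vecCons ψ Φ)) atTop
      (𝓝 (H₀ * singularProduct Φ)) :=
    (hr.mul h1).congr fun x => (singularProductPartial_vecCons Φ ψ r hloc x).symm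
  exact h2.limUnder_eq

/-! ### Registered sub-goal of this helper file -/

/-- **Part 3 of `stub_slopedEuler` (registered sub-goal `stub_slopedEuler_part3`).** If
`β_p(vecCons ψ Φ) = r_p β_p(Φ)` prime by prime and `∏_{p ≤ x} r_p → H₀`, then
`𝔖(vecCons ψ Φ) = H₀ 𝔖(Φ)` for non-degenerate `vecCons ψ Φ`. [cite: GreenTao2010, (1.7)] -/
theorem stub_slopedEuler_part3 :
    ∀ (t : ℕ) (Φ : Fin t → Literature.NumberTheory.Sieve.AffLinForm 1) (ψ : Literature.NumberTheory.Sieve.AffLinForm 1), Literature.NumberTheory.Sieve.IsNondegenerateSystem (Matrix.vecCons ψ Φ) → ∀ (r : ℕ → ℝ) (H₀ : ℝ), Filter.Tendsto (fun x : ℕ => ∏ p ∈ Nat.primesLE x, r p) Filter.atTop (nhds H₀) → (∀ p : ℕ, p.Prime → Literature.NumberTheory.Sieve.localFactor (Matrix.vecCons ψ Φ) p = r p * Literature.NumberTheory.Sieve.localFactor Φ p) → Literature.NumberTheory.Sieve.singularProduct (Matrix.vecCons ψ Φ) = H₀ * Literature.NumberTheory.Sieve.singularProduct Φ :=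
  fun _ Φ ψ hnd r H₀ hr hloc => singularProduct_vecCons Φ ψ hnd r H₀ hr hloc

end Summit.Parity.GeneralizedHardyLittlewood.Theorems.PairsToGHL.SlopedLadder
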